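import Literature.Computation.Certificates.SemidefiniteRigorousBounds

/-!
# Rigorous SDP bounds from ENCLOSURES: interval / irrational data, families over a parameter cell, and the residual upper bound (Jansson)

Topic `Literature/Computation/Certificates`, companion of `SemidefiniteRigorousBounds.lean` (Jansson–
Chaykin–Keil Lemma 3.1 / Thm 3.2 / Cor 3.1 / Thm 4.1 and the inequality-form bound `lmiForm_bound`,
all for EXACT point data with EXACTLY computed residuals). This file adds what a certificate READER
needs when the residuals are only ENCLOSED, not computed exactly — the situation of

* irrational or interval problem data (C. Jansson, *Guaranteed accuracy for conic programming
  problems in vector lattices*, arXiv:0707.4366 [Jansson2007], p. 9 after (4.3): "If interval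
  arithmetic is used, then the input data `A, b, c` may be intervals, and we obtain a lower bound for
  each instance within the interval data"; C. Jansson, D. Chaykin, C. Keil [JanssonChaykinKeil2008]
  Thm 3.2 is printed for an interval family `𝐏` of input data, with `inf{𝐛ᵀỹ}` in the bound),
* a directed-rounding / interval READER that evaluates the exact residual formula in machine
  arithmetic and obtains `|r_v| ≤ R_v`, `β ≥ β_lo` instead of `r_v`, `β`,
* ONE certificate re-used on a whole parameter CELL of programs (data depending on a parameter `θ`),
  evaluated exactly at a base point `θ₀` with bounds on the variation of the residuals over the cell
  ("box / parametric dual with computable degradation"),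

and the UPPER-bound counterpart from an approximate PRIMAL point with equality residuals:

* [Jansson2007] **Theorem 4.2** specialised to SDP = **Corollary 6.2** (p. 13): for `X̃ ⪰ 0` with
  `|⟨A_i, X̃⟩ − b_i| ≤ r̄_i` and the dual boundedness qualification (dual `ε`-optimal solutions with
  `|y| ≤ ȳ`), the dual optimal value satisfies `f̂_d ≤ ⟨C, X̃⟩ + ȳᵀ r̄`; and (b) `r̄ = 0` gives primal
  feasibility of `X̃` and `f̂_p ≤ ⟨C, X̃⟩`.

## What is proved (everything; no definitions, no named facts, no instances)

Namespace `Literature.Computation.Certificates.JanssonChaykinKeil` (inequality / LMI form of the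
fleet's conic certificates, notation of `lmiForm_bound`: variables `y ∈ ℝ^V`, unit variable `y_u = 1`,
a-priori bounds `|y_v| ≤ ρ_v (v ≠ u)`, equality rows, inequality rows, PSD blocks
`M_k(y) = C_k + Σ_v y_v F_{k,v} ⪰ 0` with trace bounds `tr M_k(y) ≤ τ_k`; certificate `λ` (free),
`κ ≥ 0`, `Z_k` with `Z_k − d_k·1 ⪰ 0`; exact residuals
`r_v = c_v − Σ_e λ_e row_e[v] + Σ_i κ_i row_i[v] − Σ_k ⟨Z_k, F_{k,v}⟩`,
`β = c₀ + r_u + Σ_e λ_e rhs_e − Σ_i κ_i upper_i − Σ_k ⟨Z_k, C_k⟩`):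

* `lmiForm_bound_of_abs_le` — ENCLOSURE FORM: if only bounds `|r_v| ≤ R_v (v ≠ u)` and `β_lo ≤ β`
  are known, every feasible `y` satisfies `β_lo − Σ_{v≠u} R_v ρ_v − Σ_k |min(0,d_k)| τ_k ≤ c·y + c₀`;
* `lmiForm_bound_family` — the same for a FAMILY of instances `t : T` (interval data: `T` = the
  realisations) with one certificate and bounds `R_v`, `β_lo` valid for every instance: the bound
  holds for every instance and every point feasible for it ("a lower bound for each instance within
  the interval data");
* `lmiForm_bound_on_cell` — DEGRADATION FORM: residuals `r(θ)`, `β(θ)` of one certificate as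
  functions of a parameter, exact values at `θ₀`, variation bounds `|r_v(θ) − r_v(θ₀)| ≤ L_v`,
  `β(θ) ≥ β(θ₀) − L_β` on a cell `S` ⇒ on all of `S`,
  `β(θ₀) − L_β − Σ_{v≠u} (|r_v(θ₀)| + L_v) ρ_v − Σ_k |min(0,d_k)| τ_k ≤ c(θ)·y + c₀(θ)`;
* `lmiForm_bound_on_box` (with the private plumbing `abs_sum_mul_sub_le`) — the affine-data BOX
  `|θ_p − θc_p| ≤ h_p`: with residual Jacobians `r_v(θ) = r_v(θc) + Σ_p J_{v,p}(θ_p − θc_p)`,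
  `β(θ) = β(θc) + Σ_p J^β_p (θ_p − θc_p)` the constants are `L_v = Σ_p |J_{v,p}| h_p`,
  `L_β = Σ_p |J^β_p| h_p` (the `ρ`-weighted `ℓ¹` norm of the residual-Jacobian columns), all
  computable exactly from the certificate and the data;
* `lmiForm_sInf_le_of_feasible` — the UPPER side in inequality form for an EXACTLY feasible point
  (order theory, the analogue of [JanssonChaykinKeil2008] Thm 4.1 = `theorem_4_1`);
* `theorem_3_2_family` — [JanssonChaykinKeil2008] **Thm 3.2 for a family of input data** (the
  printed interval statement read instance-wise: `d_j` valid for every realisation, `b_lo ≤ b(t)ᵀỹ`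
  for every realisation ⇒ `b_lo + Σ_{j∈B} s_j d_j⁻ x̄_j ≤ Σ_j ⟨C_j(t), X_j⟩` for every realisation
  `t` and every `X` feasible for it);
* `lmiForm_bound_traceBoundOn` (appendix) — `lmiForm_bound` with trace bounds only on a set `B` of
  blocks and `d_k ≥ 0` off `B` (the charge `Σ_k` becomes `Σ_{k∈B}`; Thm 3.2's (3.6)).

Namespace `Literature.Computation.Certificates.Jansson2007` (standard equality form
`min ⟨C, X⟩ s.t. ⟨A_i, X⟩ = b_i, X ⪰ 0`, dual `max bᵀy s.t. C − Σ_i y_i A_i ⪰ 0`, as in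
`SemidefiniteRigorousBoundsEigenCount.lean`):

* `corollary_6_2_pointwise` — the content of the proof of Cor. 6.2: `X̃ ⪰ 0`,
  `|⟨A_i, X̃⟩ − b_i| ≤ r̄_i` ⇒ every dual feasible `y` with `|y_i| ≤ ȳ_i` has
  `bᵀy ≤ ⟨C, X̃⟩ + Σ_i ȳ_i r̄_i`;
* `corollary_6_2a` — **Cor. 6.2 (a)** under the dual boundedness qualification DBQ (ii), stated for
  any real `f_d` approximated from below by bounded dual feasible points (the printed `f̂_d`);
* `corollary_6_2b` — **Cor. 6.2 (b)**: `r̄ = 0` ⇒ `X̃` is primal feasible and `f̂_p ≤ ⟨C, X̃⟩`.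

Design: every statement is a COROLLARY of the exact-data theorems of `SemidefiniteRigorousBounds.lean`
plus monotonicity / the triangle inequality; the point is to give certificate readers that work with
enclosures (interval readers, parametric boxes) a soundness statement whose hypotheses are exactly
the inequalities they check. Interval ARITHMETIC itself (how `R_v`, `β_lo`, `L_v` are obtained with
directed rounding) is not formalised here: the bounds are hypotheses, as everywhere in this directory.

## References

* [Jansson2007] C. Jansson, *Guaranteed accuracy for conic programming problems in vector lattices*,
  arXiv:0707.4366 (2007): Thm 4.1 (p. 8), Thm 4.2 and the interval-data remark after (4.3) (p. 9),
  Cor. 6.1 / Cor. 6.2 (p. 13) — held text `paper:arxiv-0707.4366`, pages read 2026-08-26.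
* [JanssonChaykinKeil2008] C. Jansson, D. Chaykin, C. Keil, *Rigorous error bounds for the optimal
  value in semidefinite programming*, SIAM J. Numer. Anal. 46 (2007/08) 180–200, Thm 3.2 (interval
  input data), Thm 4.1 — in the tree for exact data as `JanssonChaykinKeil.theorem_3_2`,
  `theorem_4_1`, `lmiForm_bound`.
* M. Lange, *Verification methods for conic linear programming problems*, NOLTA IEICE 11 (2020)
  327–358, §4 (interval cone-LPs; "the generalization for interval programming problems is
  straightforward", §4.1 p. 25; §4.3 p. 27 items (1)–(3): approximate dual of one realisation, a
  primal upper bound valid for all realisations, an eigenvalue lower bound with interval parameters)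
  — held text `paper:doi-10-1587-nolta-11-327`; context only.
-/

namespace Literature.Computation.Certificates

open Matrix Finset
open scoped BigOperators

namespace JanssonChaykinKeil

/-! ### The inequality (LMI) form with ENCLOSED residuals -/

section Enclosure

variable {V : Type*} [Fintype V] [DecidableEq V] {E : Type*} [Fintype E] {I : Type*} [Fintype I]
  {K : Type*} [Fintype K] {σ : K → Type*} [∀ k, Fintype (σ k)] [∀ k, DecidableEq (σ k)]

/-- theorem (ENCLOSURE FORM of the rigorous lower bound in inequality form). Same program and
certificate as `lmiForm_bound` — objective `c·y + c₀`, unit variable `y_u = 1`, a-priori bounds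
`|y_v| ≤ ρ_v (v ≠ u)`, equality rows `row_e·y = rhs_e`, inequality rows `row_i·y ≤ upper_i`, PSD
blocks `C_k + Σ_v y_v F_{k,v} ⪰ 0` with trace bounds `τ_k`; multipliers `λ` (free), `κ ≥ 0`, `Z_k` with
`Z_k − d_k·1 ⪰ 0` — but the exact residuals
`r_v = c_v − Σ_e λ_e row_e[v] + Σ_i κ_i row_i[v] − Σ_k tr(Z_k F_{k,v})` and the exact
`β = c₀ + r_u + Σ_e λ_e rhs_e − Σ_i κ_i upper_i − Σ_k tr(Z_k C_k)` are known only through bounds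
`|r_v| ≤ R_v (v ≠ u)` and `β_lo ≤ β` (what an interval / directed-rounding evaluation of these
formulas delivers, in particular for irrational or interval problem data). Then every feasible `y`
satisfies `β_lo − Σ_{v ≠ u} R_v ρ_v − Σ_k |min(0, d_k)| τ_k ≤ c·y + c₀`.
SOURCE: [cite: Jansson2007, Thm 4.2 and remark after (4.3), p. 9] ("If interval arithmetic is used,
then the input data may be intervals, and we obtain a lower bound for each instance within the
interval data") — read on the page 2026-08-26; mechanism [cite: JanssonChaykinKeil2008, Lemma 3.1
and Thm 3.2 (inequality-form corollary)] through `lmiForm_bound`. DEVIATIONS from print: a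
COROLLARY, not a printed theorem — `lmiForm_bound` with the exact residual terms replaced by upper
bounds (monotonicity: `ρ_v ≥ |y_v| ≥ 0`).
CERTIFICATE KIND: conic/1 (gram: `d_k = 0`; dyadic-eig: `d_k` from a chol-residual witness) read
by an INTERVAL / directed-rounding reader; FIELDS: `lam ↦ eq multipliers`, `κ ↦ ineq multipliers`,
`Z, dZ ↦ psd blocks + eig certificate`, `R ↦ sup |residual enclosure|`, `βlo ↦ inf of the β
enclosure`, `ρ, τ ↦ a-priori bounds of the problem file`.
NOT COVERED: how `R_v`, `β_lo` are computed (the reader's interval arithmetic), the parsing of the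
files, the float solver; unbounded variables (every `v ≠ u` carries a finite `ρ_v` here). -/
theorem lmiForm_bound_of_abs_le (c : V → ℝ) (c0 : ℝ) (u : V)
    (rowE : E → V → ℝ) (rhs : E → ℝ) (rowI : I → V → ℝ) (upper : I → ℝ)
    (Cb : ∀ k, Matrix (σ k) (σ k) ℝ) (F : ∀ k, V → Matrix (σ k) (σ k) ℝ)
    (ρ : V → ℝ) (τ : K → ℝ)
    -- a feasible point
    {y : V → ℝ} (hyu : y u = 1) (hρ : ∀ v, v ≠ u → |y v| ≤ ρ v)
    (heq : ∀ e, ∑ v, rowE e v * y v = rhs e) (hineq : ∀ i, ∑ v, rowI i v * y v ≤ upper i)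
    (hpsd : ∀ k, (Cb k + ∑ v, y v • F k v).PosSemidef)
    (hτ : ∀ k, trace (Cb k + ∑ v, y v • F k v) ≤ τ k)
    -- the certificate
    (lam : E → ℝ) (κ : I → ℝ) (hκ : ∀ i, 0 ≤ κ i) (Z : ∀ k, Matrix (σ k) (σ k) ℝ) (dZ : K → ℝ)
    (hZ : ∀ k, (Z k - dZ k • (1 : Matrix (σ k) (σ k) ℝ)).PosSemidef)
    -- enclosures of the residuals
    (R : V → ℝ)
    (hR : ∀ v, v ≠ u →
      |c v - ∑ e, lam e * rowE e v + ∑ i, κ i * rowI i v - ∑ k, trace (Z k * F k v)| ≤ R v)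
    (βlo : ℝ)
    (hβ : βlo ≤ c0 + (c u - ∑ e, lam e * rowE e u + ∑ i, κ i * rowI i u - ∑ k, trace (Z k * F k u))
      + ∑ e, lam e * rhs e - ∑ i, κ i * upper i - ∑ k, trace (Z k * Cb k)) :
    βlo - ∑ v ∈ Finset.univ.erase u, R v * ρ v - ∑ k, |min 0 (dZ k)| * τ k ≤
      ∑ v, c v * y v + c0 := by
  have hmain := lmiForm_bound c c0 u rowE rhs rowI upper Cb F ρ τ hyu hρ heq hineq hpsd hτ lam κ hκ
    Z dZ hZ (fun v => c v - ∑ e, lam e * rowE e v + ∑ i, κ i * rowI i v - ∑ k, trace (Z k * F k v))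
    (fun _ => rfl)
    (c0 + (c u - ∑ e, lam e * rowE e u + ∑ i, κ i * rowI i u - ∑ k, trace (Z k * F k u))
      + ∑ e, lam e * rhs e - ∑ i, κ i * upper i - ∑ k, trace (Z k * Cb k)) rfl
  have hsum : ∑ v ∈ Finset.univ.erase u,
      |c v - ∑ e, lam e * rowE e v + ∑ i, κ i * rowI i v - ∑ k, trace (Z k * F k v)| * ρ v ≤
      ∑ v ∈ Finset.univ.erase u, R v * ρ v := by
    refine Finset.sum_le_sum fun v hv => ?_
    have hvu : v ≠ u := Finset.ne_of_mem_erase hv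
    exact mul_le_mul_of_nonneg_right (hR v hvu) (le_trans (abs_nonneg _) (hρ v hvu))
  linarith

/-- theorem (rigorous lower bound for EVERY INSTANCE of a family of data — the interval-data case).
A family of inequality-form programs indexed by `t : T` (for interval input data, `T` = the set of
realisations): data `c t, c₀ t, row_e t, rhs t, row_i t, upper t, C_k t, F_{k,v} t`, common a-priori
bounds `ρ`, `τ`, and ONE certificate `(λ, κ ≥ 0, Z_k ⪰ d_k·1)`. If `R_v ≥ |r_v(t)|` (`v ≠ u`) and
`β_lo ≤ β(t)` hold for EVERY instance `t` (one interval evaluation of the residual formulas over the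
data intervals), then for every instance `t` and every `y` feasible for instance `t`:
`β_lo − Σ_{v≠u} R_v ρ_v − Σ_k |min(0,d_k)| τ_k ≤ c(t)·y + c₀(t)` — "a lower bound for each instance
within the interval data".
SOURCE: [cite: Jansson2007, remark after (4.3), p. 9] — read on the page 2026-08-26;
[cite: JanssonChaykinKeil2008, Thm 3.2 (interval input data 𝐏)]. DEVIATIONS from print: the
interval family is an arbitrary index type `T`; inequality (LMI) form (the printed Thm 3.2 is the
equality standard form — see `theorem_3_2_family`); a COROLLARY of `lmiForm_bound_of_abs_le`.
CERTIFICATE KIND: conic/1 over interval problem data, interval reader; FIELDS as in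
`lmiForm_bound_of_abs_le`.
NOT COVERED: the interval evaluation producing `R`, `β_lo`; instance-dependent a-priori bounds (use
`lmiForm_bound_of_abs_le` per instance). -/
theorem lmiForm_bound_family {T : Type*} (c : T → V → ℝ) (c0 : T → ℝ) (u : V)
    (rowE : T → E → V → ℝ) (rhs : T → E → ℝ) (rowI : T → I → V → ℝ) (upper : T → I → ℝ)
    (Cb : T → ∀ k, Matrix (σ k) (σ k) ℝ) (F : T → ∀ k, V → Matrix (σ k) (σ k) ℝ)
    (ρ : V → ℝ) (τ : K → ℝ)
    -- ONE certificate for the whole family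
    (lam : E → ℝ) (κ : I → ℝ) (hκ : ∀ i, 0 ≤ κ i) (Z : ∀ k, Matrix (σ k) (σ k) ℝ) (dZ : K → ℝ)
    (hZ : ∀ k, (Z k - dZ k • (1 : Matrix (σ k) (σ k) ℝ)).PosSemidef)
    -- enclosures valid for every instance
    (R : V → ℝ)
    (hR : ∀ t, ∀ v, v ≠ u →
      |c t v - ∑ e, lam e * rowE t e v + ∑ i, κ i * rowI t i v - ∑ k, trace (Z k * F t k v)| ≤ R v)
    (βlo : ℝ)
    (hβ : ∀ t, βlo ≤ c0 t
      + (c t u - ∑ e, lam e * rowE t e u + ∑ i, κ i * rowI t i u - ∑ k, trace (Z k * F t k u))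
      + ∑ e, lam e * rhs t e - ∑ i, κ i * upper t i - ∑ k, trace (Z k * Cb t k))
    -- an instance and a point feasible for it
    (t : T) {y : V → ℝ} (hyu : y u = 1) (hρ : ∀ v, v ≠ u → |y v| ≤ ρ v)
    (heq : ∀ e, ∑ v, rowE t e v * y v = rhs t e) (hineq : ∀ i, ∑ v, rowI t i v * y v ≤ upper t i)
    (hpsd : ∀ k, (Cb t k + ∑ v, y v • F t k v).PosSemidef)
    (hτ : ∀ k, trace (Cb t k + ∑ v, y v • F t k v) ≤ τ k) :
    βlo - ∑ v ∈ Finset.univ.erase u, R v * ρ v - ∑ k, |min 0 (dZ k)| * τ k ≤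
      ∑ v, c t v * y v + c0 t :=
  lmiForm_bound_of_abs_le (c t) (c0 t) u (rowE t) (rhs t) (rowI t) (upper t) (Cb t) (F t) ρ τ hyu hρ
    heq hineq hpsd hτ lam κ hκ Z dZ hZ R (hR t) βlo (hβ t)

/-! ### One certificate on a parameter CELL: the degradation form -/

/-- theorem (DEGRADATION FORM: one certificate re-used on a parameter cell). Programs in inequality
form whose data depend on a parameter `θ : T`; ONE certificate `(λ, κ ≥ 0, Z_k ⪰ d_k·1)`; its exact
residuals `r θ v` and `β θ` written as functions of `θ` (hypotheses `hr`, `hβ` are their defining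
formulas). If on a cell `S ⊆ T` the variation is bounded, `|r θ v − r θ₀ v| ≤ L_v (v ≠ u)` and
`β θ₀ − L_β ≤ β θ` for `θ ∈ S` (for data affine in `θ` on a box these constants are explicit:
`lmiForm_bound_on_box`), then for every `θ ∈ S` and every `y` feasible for the instance at `θ`:
`β θ₀ − L_β − Σ_{v≠u} (|r θ₀ v| + L_v) ρ_v − Σ_k |min(0,d_k)| τ_k ≤ c(θ)·y + c₀(θ)` — the bound
certified exactly at `θ₀`, degraded by `L_β + Σ_{v≠u} L_v ρ_v` over the cell.
SOURCE: mechanism [cite: Jansson2007, Thm 4.2 (residual term ⟨ȳ, r̄⟩) and remark after (4.3),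
p. 9] — read on the page 2026-08-26; [cite: JanssonChaykinKeil2008, Thm 3.2]. DEVIATIONS from
print: a COROLLARY (triangle inequality on top of `lmiForm_bound_of_abs_le`); not a statement of
either source. CERTIFICATE KIND: box / parametric conic certificate, shape "one dual at `θ₀` +
Lipschitz degradation" (certsdp-box lineage); FIELDS: `r θ₀, β θ₀ ↦ exact residuals at the base
point`, `L, Lβ ↦ variation bounds over the cell`, `S ↦ the cell`.
NOT COVERED: how `L`, `L_β` are obtained for non-affine data; θ-dependent a-priori bounds `ρ`, `τ`
(taken uniform on the cell); optimality of the degraded bound (the vertex rule of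
`SharedVaryingBoxCertificate.lean` is tighter when all vertices are evaluated). -/
theorem lmiForm_bound_on_cell {T : Type*} (S : Set T) (c : T → V → ℝ) (c0 : T → ℝ) (u : V)
    (rowE : T → E → V → ℝ) (rhs : T → E → ℝ) (rowI : T → I → V → ℝ) (upper : T → I → ℝ)
    (Cb : T → ∀ k, Matrix (σ k) (σ k) ℝ) (F : T → ∀ k, V → Matrix (σ k) (σ k) ℝ)
    (ρ : V → ℝ) (τ : K → ℝ)
    -- ONE certificate for the whole cell
    (lam : E → ℝ) (κ : I → ℝ) (hκ : ∀ i, 0 ≤ κ i) (Z : ∀ k, Matrix (σ k) (σ k) ℝ) (dZ : K → ℝ)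
    (hZ : ∀ k, (Z k - dZ k • (1 : Matrix (σ k) (σ k) ℝ)).PosSemidef)
    -- its exact residuals as functions of the parameter
    (r : T → V → ℝ)
    (hr : ∀ θ v, r θ v =
      c θ v - ∑ e, lam e * rowE θ e v + ∑ i, κ i * rowI θ i v - ∑ k, trace (Z k * F θ k v))
    (β : T → ℝ)
    (hβ : ∀ θ, β θ =
      c0 θ + r θ u + ∑ e, lam e * rhs θ e - ∑ i, κ i * upper θ i - ∑ k, trace (Z k * Cb θ k))
    -- exact evaluation at a base point, variation bounds on the cell
    (θ₀ : T) (L : V → ℝ) (hL : ∀ θ ∈ S, ∀ v, v ≠ u → |r θ v - r θ₀ v| ≤ L v)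
    (Lβ : ℝ) (hLβ : ∀ θ ∈ S, β θ₀ - Lβ ≤ β θ)
    -- an instance in the cell and a point feasible for it
    {θ : T} (hθ : θ ∈ S) {y : V → ℝ} (hyu : y u = 1) (hρ : ∀ v, v ≠ u → |y v| ≤ ρ v)
    (heq : ∀ e, ∑ v, rowE θ e v * y v = rhs θ e) (hineq : ∀ i, ∑ v, rowI θ i v * y v ≤ upper θ i)
    (hpsd : ∀ k, (Cb θ k + ∑ v, y v • F θ k v).PosSemidef)
    (hτ : ∀ k, trace (Cb θ k + ∑ v, y v • F θ k v) ≤ τ k) :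
    β θ₀ - Lβ - ∑ v ∈ Finset.univ.erase u, (|r θ₀ v| + L v) * ρ v - ∑ k, |min 0 (dZ k)| * τ k ≤
      ∑ v, c θ v * y v + c0 θ := by
  have hR : ∀ v, v ≠ u →
      |c θ v - ∑ e, lam e * rowE θ e v + ∑ i, κ i * rowI θ i v - ∑ k, trace (Z k * F θ k v)| ≤
        |r θ₀ v| + L v := by
    intro v hv
    rw [← hr θ v]
    have h1 := hL θ hθ v hv
    have h2 := abs_sub_abs_le_abs_sub (r θ v) (r θ₀ v)
    linarith
  have hβlo : β θ₀ - Lβ ≤ c0 θ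
      + (c θ u - ∑ e, lam e * rowE θ e u + ∑ i, κ i * rowI θ i u - ∑ k, trace (Z k * F θ k u))
      + ∑ e, lam e * rhs θ e - ∑ i, κ i * upper θ i - ∑ k, trace (Z k * Cb θ k) := by
    have h1 := hLβ θ hθ
    rw [hβ θ, hr θ u] at h1
    linarith
  exact lmiForm_bound_of_abs_le (c θ) (c0 θ) u (rowE θ) (rhs θ) (rowI θ) (upper θ) (Cb θ) (F θ) ρ τ
    hyu hρ heq hineq hpsd hτ lam κ hκ Z dZ hZ (fun v => |r θ₀ v| + L v) hR (β θ₀ - Lβ) hβlo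

/-- theorem (variation of an affine function over a coordinate box). If `|θ_p − θc_p| ≤ h_p` for
every coordinate `p`, then `|Σ_p g_p (θ_p − θc_p)| ≤ Σ_p |g_p| h_p` — the `h`-weighted `ℓ¹` norm of
the gradient `g` bounds the variation of the affine map `θ ↦ a + Σ_p g_p θ_p` over the box
(plumbing for `lmiForm_bound_on_box`). [folklore] -/
private theorem abs_sum_mul_sub_le {P : Type*} [Fintype P] (g θ θc h : P → ℝ)
    (hθ : ∀ p, |θ p - θc p| ≤ h p) :
    |∑ p, g p * (θ p - θc p)| ≤ ∑ p, |g p| * h p :=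
  calc |∑ p, g p * (θ p - θc p)| ≤ ∑ p, |g p * (θ p - θc p)| := Finset.abs_sum_le_sum_abs _ _
    _ = ∑ p, |g p| * |θ p - θc p| := by simp_rw [abs_mul]
    _ ≤ ∑ p, |g p| * h p :=
        Finset.sum_le_sum fun p _ => mul_le_mul_of_nonneg_left (hθ p) (abs_nonneg _)

/-- theorem (ONE CERTIFICATE ON A COORDINATE BOX with affine data: explicit degradation constants).
Parameter `θ : P → ℝ` in the box `|θ_p − θc_p| ≤ h_p`; the exact residuals of the certificate are
affine in `θ` on the box with Jacobians `J` and `J^β` computed from the data: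
`r θ v = r θc v + Σ_p J_{v,p} (θ_p − θc_p)` (`v ≠ u`) and `β θ = β θc + Σ_p J^β_p (θ_p − θc_p)`.
Then for every `θ` in the box and every `y` feasible for the instance at `θ`:
`β θc − Σ_p |J^β_p| h_p − Σ_{v≠u} (|r θc v| + Σ_p |J_{v,p}| h_p) ρ_v − Σ_k |min(0,d_k)| τ_k
 ≤ c(θ)·y + c₀(θ)`, i.e. the exact bound at the centre degraded by
`Σ_p h_p (|J^β_p| + Σ_{v≠u} ρ_v |J_{v,p}|)` — the `ρ`-weighted `ℓ¹` norm of the residual-Jacobian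
columns times the box radii.
SOURCE: mechanism [cite: Jansson2007, Thm 4.2 and remark after (4.3), p. 9] — read on the page
2026-08-26; [cite: JanssonChaykinKeil2008, Thm 3.2]. DEVIATIONS from print: a COROLLARY of
`lmiForm_bound_on_cell` (cell = the box, `L_v = Σ_p |J_{v,p}| h_p`, `L_β = Σ_p |J^β_p| h_p`); not a
statement of either source. CERTIFICATE KIND: box conic certificate (one dual + residual Jacobian;
certsdp-box / hubbard-fast lineage, parameters e.g. `(U, t′)`); FIELDS: `θc, h ↦ box centre and
radii`, `J, Jβ ↦ exact residual Jacobians`, the rest as in `lmiForm_bound_on_cell`.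
NOT COVERED: non-affine parameter dependence; θ-dependent a-priori bounds; tightness (evaluate all
`2^|P|` vertices with `SharedVaryingBoxCertificate.lean` for the exact minimum of the concave bound). -/
theorem lmiForm_bound_on_box {P : Type*} [Fintype P] (θc h : P → ℝ)
    (c : (P → ℝ) → V → ℝ) (c0 : (P → ℝ) → ℝ) (u : V)
    (rowE : (P → ℝ) → E → V → ℝ) (rhs : (P → ℝ) → E → ℝ) (rowI : (P → ℝ) → I → V → ℝ)
    (upper : (P → ℝ) → I → ℝ)
    (Cb : (P → ℝ) → ∀ k, Matrix (σ k) (σ k) ℝ) (F : (P → ℝ) → ∀ k, V → Matrix (σ k) (σ k) ℝ)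
    (ρ : V → ℝ) (τ : K → ℝ)
    -- ONE certificate for the whole box
    (lam : E → ℝ) (κ : I → ℝ) (hκ : ∀ i, 0 ≤ κ i) (Z : ∀ k, Matrix (σ k) (σ k) ℝ) (dZ : K → ℝ)
    (hZ : ∀ k, (Z k - dZ k • (1 : Matrix (σ k) (σ k) ℝ)).PosSemidef)
    -- its exact residuals as functions of the parameter, affine on the box
    (r : (P → ℝ) → V → ℝ)
    (hr : ∀ θ v, r θ v =
      c θ v - ∑ e, lam e * rowE θ e v + ∑ i, κ i * rowI θ i v - ∑ k, trace (Z k * F θ k v))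
    (β : (P → ℝ) → ℝ)
    (hβ : ∀ θ, β θ =
      c0 θ + r θ u + ∑ e, lam e * rhs θ e - ∑ i, κ i * upper θ i - ∑ k, trace (Z k * Cb θ k))
    (J : V → P → ℝ)
    (hJ : ∀ θ : P → ℝ, (∀ p, |θ p - θc p| ≤ h p) → ∀ v, v ≠ u →
      r θ v = r θc v + ∑ p, J v p * (θ p - θc p))
    (Jβ : P → ℝ)
    (hJβ : ∀ θ : P → ℝ, (∀ p, |θ p - θc p| ≤ h p) → β θ = β θc + ∑ p, Jβ p * (θ p - θc p))
    -- an instance in the box and a point feasible for it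
    {θ : P → ℝ} (hθ : ∀ p, |θ p - θc p| ≤ h p) {y : V → ℝ} (hyu : y u = 1)
    (hρ : ∀ v, v ≠ u → |y v| ≤ ρ v)
    (heq : ∀ e, ∑ v, rowE θ e v * y v = rhs θ e) (hineq : ∀ i, ∑ v, rowI θ i v * y v ≤ upper θ i)
    (hpsd : ∀ k, (Cb θ k + ∑ v, y v • F θ k v).PosSemidef)
    (hτ : ∀ k, trace (Cb θ k + ∑ v, y v • F θ k v) ≤ τ k) :
    β θc - ∑ p, |Jβ p| * h p
      - ∑ v ∈ Finset.univ.erase u, (|r θc v| + ∑ p, |J v p| * h p) * ρ v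
      - ∑ k, |min 0 (dZ k)| * τ k ≤ ∑ v, c θ v * y v + c0 θ := by
  refine lmiForm_bound_on_cell {θ' : P → ℝ | ∀ p, |θ' p - θc p| ≤ h p} c c0 u rowE rhs rowI upper
    Cb F ρ τ lam κ hκ Z dZ hZ r hr β hβ θc (fun v => ∑ p, |J v p| * h p) ?_ (∑ p, |Jβ p| * h p) ?_
    hθ hyu hρ heq hineq hpsd hτ
  · intro θ' hθ' v hv
    rw [hJ θ' hθ' v hv, add_sub_cancel_left]
    exact abs_sum_mul_sub_le (J v) θ' θc h hθ'
  · intro θ' hθ'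
    have h1 := abs_sum_mul_sub_le Jβ θ' θc h hθ'
    have h2 := neg_abs_le (∑ p, Jβ p * (θ' p - θc p))
    rw [hJβ θ' hθ']
    linarith

/-! ### The upper side in inequality form: an exactly feasible point -/

omit [DecidableEq V] [Fintype E] [Fintype I] [Fintype K] [∀ k, Fintype (σ k)]
  [∀ k, DecidableEq (σ k)] in
/-- theorem (upper bound of the optimal value in inequality form from an EXACTLY feasible point).
For the inequality-form program of `lmiForm_bound` (unit variable, a-priori bounds, equality and
inequality rows, PSD blocks), any feasible `ỹ` bounds the optimal value — the infimum of `c·y + c₀`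
over the feasible set — from above: `inf ≤ c·ỹ + c₀` (the feasible set is bounded below in value, e.g.
by `lmiForm_bound`). Feasibility of `ỹ` (exact rows, `M_k(ỹ) ⪰ 0` by an exact PSD certificate) is
the hypothesis. SOURCE: [cite: JanssonChaykinKeil2008, Thm 4.1] (exact data; the inequality-form
analogue of `theorem_4_1`); [cite: Jansson2007, Cor. 6.2 (b), p. 13]. DEVIATIONS from print:
inequality (LMI) form instead of the standard equality form; the point is exactly feasible (no
enclosure `𝐗`). CERTIFICATE KIND: primal-feasible-point upper certificate (exact ℚ point + exact
PSD certificates of `M_k(ỹ)`); FIELDS: `yt ↦ the point`.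
NOT COVERED: approximately feasible points (need a repair step or the boundedness qualification of
[Jansson2007] Thm 4.1 on the multiplier side); how PSD of `M_k(ỹ)` is certified. -/
theorem lmiForm_sInf_le_of_feasible (c : V → ℝ) (c0 : ℝ) (u : V)
    (rowE : E → V → ℝ) (rhs : E → ℝ) (rowI : I → V → ℝ) (upper : I → ℝ)
    (Cb : ∀ k, Matrix (σ k) (σ k) ℝ) (F : ∀ k, V → Matrix (σ k) (σ k) ℝ) (ρ : V → ℝ)
    {yt : V → ℝ} (hyu : yt u = 1) (hρ : ∀ v, v ≠ u → |yt v| ≤ ρ v)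
    (heq : ∀ e, ∑ v, rowE e v * yt v = rhs e) (hineq : ∀ i, ∑ v, rowI i v * yt v ≤ upper i)
    (hpsd : ∀ k, (Cb k + ∑ v, yt v • F k v).PosSemidef)
    (hbdd : BddBelow {val : ℝ | ∃ y : V → ℝ, y u = 1 ∧ (∀ v, v ≠ u → |y v| ≤ ρ v) ∧
      (∀ e, ∑ v, rowE e v * y v = rhs e) ∧ (∀ i, ∑ v, rowI i v * y v ≤ upper i) ∧
      (∀ k, (Cb k + ∑ v, y v • F k v).PosSemidef) ∧ val = ∑ v, c v * y v + c0}) :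
    sInf {val : ℝ | ∃ y : V → ℝ, y u = 1 ∧ (∀ v, v ≠ u → |y v| ≤ ρ v) ∧
      (∀ e, ∑ v, rowE e v * y v = rhs e) ∧ (∀ i, ∑ v, rowI i v * y v ≤ upper i) ∧
      (∀ k, (Cb k + ∑ v, y v • F k v).PosSemidef) ∧ val = ∑ v, c v * y v + c0} ≤
      ∑ v, c v * yt v + c0 :=
  csInf_le hbdd ⟨yt, hyu, hρ, heq, hineq, hpsd, rfl⟩

end Enclosure

/-! ### Theorem 3.2 for a family of input data (the printed interval statement, instance-wise) -/

section Family32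

variable {ι : Type*} [Fintype ι] {σ : ι → Type*} [∀ j, Fintype (σ j)] [∀ j, DecidableEq (σ j)]
  {μ : Type*} [Fintype μ]

/-- theorem (**Jansson–Chaykin–Keil, Theorem 3.2, for a family of input data**). A family of
primal block SDPs indexed by `t : T` (the realisations `P ∈ 𝐏` of interval input data):
`min Σ_j ⟨C_j(t), X_j⟩ s.t. Σ_j ⟨A_ij(t), X_j⟩ = b_i(t), X_j ⪰ 0`. Let `ỹ` be fixed, `d_j` with
`C_j(t) − Σ_i ỹ_i A_ij(t) − d_j·1 ⪰ 0` for EVERY realisation (in the source: `d_j ≤ λ_min` of an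
interval matrix `𝐃_j` enclosing all `C_j(P) − Σ_i ỹ_i A_ij(P)`), `B` the set of blocks with a-priori
bounds `x̄_j·1 − X_j ⪰ 0` on the feasible points, `d_j ≥ 0` off `B`, and `b_lo ≤ b(t)ᵀỹ` for every
realisation (the printed `inf{𝐛ᵀỹ}`). Then for every realisation `t` and every `X` feasible for it,
`b_lo + Σ_{j∈B} s_j d_j⁻ x̄_j ≤ Σ_j ⟨C_j(t), X_j⟩`; hence `p̲* ≤ p*(P)` for all `P ∈ 𝐏`.
SOURCE: [cite: JanssonChaykinKeil2008, Thm 3.2 (interval input data), (3.3)–(3.7)];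
[cite: Jansson2007, remark after (4.3), p. 9] — read on the page 2026-08-26. DEVIATIONS from
print: the interval family is an arbitrary index type `T` with the inf written as a common lower
bound `b_lo`; a COROLLARY of the exact-data `theorem_3_2` applied instance-wise.
CERTIFICATE KIND: standard-form SDP, inexact dual + eigen-shift over interval data (VSDP lineage);
FIELDS: `y ↦ approximate dual`, `d ↦ eigenvalue lower bounds valid for all realisations`,
`xub, B ↦ a-priori bounds`, `blo ↦ inf of the interval evaluation of bᵀỹ`.
NOT COVERED: the interval eigenvalue computation producing `d`; realisation-dependent `x̄`. -/
theorem theorem_3_2_family {T : Type*} (C : T → ∀ j, Matrix (σ j) (σ j) ℝ)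
    (A : T → μ → ∀ j, Matrix (σ j) (σ j) ℝ) (b : T → μ → ℝ) (y : μ → ℝ) (d : ι → ℝ)
    (hD : ∀ t j, (C t j - ∑ i, y i • A t i j - d j • (1 : Matrix (σ j) (σ j) ℝ)).PosSemidef)
    (B : Finset ι) (xub : ι → ℝ) (hd : ∀ j ∉ B, 0 ≤ d j)
    (blo : ℝ) (hblo : ∀ t, blo ≤ ∑ i, b t i * y i)
    (t : T) {X : ∀ j, Matrix (σ j) (σ j) ℝ} (hX : ∀ j, (X j).PosSemidef)
    (hAX : ∀ i, ∑ j, trace (A t i j * X j) = b t i)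
    (hub : ∀ j ∈ B, (xub j • (1 : Matrix (σ j) (σ j) ℝ) - X j).PosSemidef) :
    blo + ∑ j ∈ B, Fintype.card (σ j) * min (d j) 0 * xub j ≤ ∑ j, trace (C t j * X j) := by
  have h := theorem_3_2 (C t) (A t) (b t) hX hAX y d (hD t) B xub hub hd
  have h2 := hblo t
  linarith

end Family32

end JanssonChaykinKeil

/-! ### Jansson 2007, Corollary 6.2: the upper bound from an approximate primal point with residuals -/

namespace Jansson2007

variable {n : Type*} [Fintype n] [DecidableEq n] {μ : Type*} [Fintype μ]

omit [DecidableEq n] in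
/-- theorem (the pointwise content of [Jansson2007] Cor. 6.2 (a)). Standard primal SDP
`min ⟨C, X⟩ s.t. ⟨A_i, X⟩ = b_i (i = 1..m), X ⪰ 0` with dual `max bᵀy s.t. C − Σ_i y_i A_i ⪰ 0`.
Let `X̃ ⪰ 0` (an approximate primal point, shifted into the cone if necessary) with equality
residuals `|⟨A_i, X̃⟩ − b_i| ≤ r̄_i`. Then EVERY dual feasible `y` with `|y_i| ≤ ȳ_i` satisfies
`bᵀy ≤ ⟨C, X̃⟩ + Σ_i ȳ_i r̄_i`. (Proof as printed for Thm 4.2: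
`bᵀy = ⟨C, X̃⟩ − ⟨C − Σ y_i A_i, X̃⟩ − Σ_i y_i(⟨A_i, X̃⟩ − b_i)`, the middle term is `≥ 0` as an inner
product of PSD matrices, the last is `≤ ȳᵀr̄`.)
SOURCE: [cite: Jansson2007, Thm 4.2 (proof) and Cor. 6.2, pp. 9 and 13] — read on the page
2026-08-26. DEVIATIONS from print: none in the hypotheses (`X̃ ∈ S_+`, residual bound (6.11)); the
conclusion is the pointwise inequality for bounded dual feasible `y` from which (a) follows under
DBQ (`corollary_6_2a`). CERTIFICATE KIND: primal-residual upper certificate (approximate `X̃ ⪰ 0` +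
residual enclosure `r̄` + a-priori dual bound `ȳ`); FIELDS: `Xt ↦ X̃`, `rbar ↦ r̄`, `ybar ↦ ȳ`.
NOT COVERED: certifying `X̃ ⪰ 0` (eigen-shift, p. 13 after the proof); where `ȳ` comes from. -/
theorem corollary_6_2_pointwise (C : Matrix n n ℝ) (A : μ → Matrix n n ℝ) (b : μ → ℝ)
    {Xt : Matrix n n ℝ} (hXt : Xt.PosSemidef) (rbar : μ → ℝ)
    (hres : ∀ i, |trace (A i * Xt) - b i| ≤ rbar i) (ybar : μ → ℝ)
    {y : μ → ℝ} (hy : (C - ∑ i, y i • A i).PosSemidef) (hyb : ∀ i, |y i| ≤ ybar i) :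
    ∑ i, b i * y i ≤ trace (C * Xt) + ∑ i, ybar i * rbar i := by
  have h1 : 0 ≤ trace ((C - ∑ i, y i • A i) * Xt) := trace_mul_nonneg_of_posSemidef hy hXt
  have h2 : trace ((C - ∑ i, y i • A i) * Xt) = trace (C * Xt) - ∑ i, y i * trace (A i * Xt) := by
    rw [sub_mul, Matrix.trace_sub, Finset.sum_mul, Matrix.trace_sum]
    simp only [Matrix.smul_mul, Matrix.trace_smul, smul_eq_mul]
  have h3 : ∀ i, b i * y i ≤ y i * trace (A i * Xt) + ybar i * rbar i := by
    intro i
    have ha := hres i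
    have hb := hyb i
    have h4 : |y i * (trace (A i * Xt) - b i)| ≤ ybar i * rbar i := by
      rw [abs_mul]
      exact mul_le_mul hb ha (abs_nonneg _) (le_trans (abs_nonneg _) hb)
    have h5 := neg_abs_le (y i * (trace (A i * Xt) - b i))
    have h6 : b i * y i = y i * trace (A i * Xt) - y i * (trace (A i * Xt) - b i) := by ring
    rw [h6]
    linarith
  have h7 := Finset.sum_le_sum fun i (_ : i ∈ Finset.univ) => h3 i
  rw [Finset.sum_add_distrib] at h7
  linarith

omit [DecidableEq n] in
/-- theorem (**Jansson 2007, Corollary 6.2 (a)** = Thm 4.2 for SDP). Assume the dual boundedness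
qualification DBQ (ii): the dual optimal value `f̂_d` is finite and there is a simple bound `ȳ` such
that for every `ε > 0` some dual feasible `y(ε)` has `|y(ε)| ≤ ȳ` and `f̂_d − bᵀy(ε) ≤ ε` (here
`f̂_d` is any real `fd` with this approximation property — the printed `f̂_d = sup` has it by DBQ).
Let `X̃ ⪰ 0` with `|⟨A_i, X̃⟩ − b_i| ≤ r̄_i (i = 1..m)`. Then `f̂_d ≤ ⟨C, X̃⟩ + ȳᵀ r̄ =: f̄_d`.
(DBQ (i), dual infeasible, means `f̂_d = −∞` and has no content for a real `fd`.)
SOURCE: [cite: Jansson2007, Cor. 6.2 (a), (6.11)–(6.12), p. 13; Thm 4.2, p. 9] — read on the page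
2026-08-26. DEVIATIONS from print: `f̂_d` entered as a real number with the DBQ (ii) property rather
than as an extended-real supremum. CERTIFICATE KIND: primal-residual upper certificate; FIELDS: as in
`corollary_6_2_pointwise`, `fd ↦ the dual optimal value`.
NOT COVERED: verifying DBQ; the eigen-shift making `X̃ ⪰ 0`. -/
theorem corollary_6_2a (C : Matrix n n ℝ) (A : μ → Matrix n n ℝ) (b : μ → ℝ)
    {Xt : Matrix n n ℝ} (hXt : Xt.PosSemidef) (rbar : μ → ℝ)
    (hres : ∀ i, |trace (A i * Xt) - b i| ≤ rbar i) (ybar : μ → ℝ) (fd : ℝ)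
    (hDBQ : ∀ ε > 0, ∃ y : μ → ℝ, (C - ∑ i, y i • A i).PosSemidef ∧ (∀ i, |y i| ≤ ybar i) ∧
      fd - ε ≤ ∑ i, b i * y i) :
    fd ≤ trace (C * Xt) + ∑ i, ybar i * rbar i := by
  refine le_of_forall_pos_le_add fun ε hε => ?_
  obtain ⟨y, hy, hyb, hfd⟩ := hDBQ ε hε
  have h := corollary_6_2_pointwise C A b hXt rbar hres ybar hy hyb
  linarith

omit [DecidableEq n] [Fintype μ] in
/-- theorem (**Jansson 2007, Corollary 6.2 (b)**). If the residual bound is `r̄ = 0` then `X̃ ⪰ 0`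
is primal feasible, `⟨A_i, X̃⟩ = b_i`, and the primal optimal value — the infimum of `⟨C, X⟩` over
the primal feasible set, assumed bounded below — satisfies `f̂_p ≤ f̄_d = ⟨C, X̃⟩`.
SOURCE: [cite: Jansson2007, Cor. 6.2 (b), p. 13] — read on the page 2026-08-26; the same order
fact as [cite: JanssonChaykinKeil2008, Thm 4.1] (`JanssonChaykinKeil.theorem_4_1`, block form).
DEVIATIONS from print: `f̂_p` as `sInf` over the feasible values with an explicit `BddBelow`
hypothesis (the printed value may be `−∞` otherwise); the clause "if moreover `X̃` is optimal then
`f̂_p = f̄_d`" is omitted (definition of optimality). CERTIFICATE KIND: exact primal feasible point;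
FIELDS: `Xt ↦ X̃`. NOT COVERED: how exact feasibility (`r̄ = 0`) is achieved (rational repair). -/
theorem corollary_6_2b (C : Matrix n n ℝ) (A : μ → Matrix n n ℝ) (b : μ → ℝ)
    {Xt : Matrix n n ℝ} (hXt : Xt.PosSemidef) (hres : ∀ i, |trace (A i * Xt) - b i| ≤ 0)
    (hbdd : BddBelow {v : ℝ | ∃ X : Matrix n n ℝ, X.PosSemidef ∧ (∀ i, trace (A i * X) = b i) ∧
      v = trace (C * X)}) :
    (∀ i, trace (A i * Xt) = b i) ∧
      sInf {v : ℝ | ∃ X : Matrix n n ℝ, X.PosSemidef ∧ (∀ i, trace (A i * X) = b i) ∧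
        v = trace (C * X)} ≤ trace (C * Xt) := by
  have hfeas : ∀ i, trace (A i * Xt) = b i := fun i =>
    sub_eq_zero.mp (abs_nonpos_iff.mp (hres i))
  exact ⟨hfeas, csInf_le hbdd ⟨Xt, hXt, hfeas, rfl⟩⟩

end Jansson2007

/-! ### Appendix (appended 2026-08-26): trace bounds only where they are needed -/

namespace JanssonChaykinKeil

section TraceBoundOn

variable {V : Type*} [Fintype V] [DecidableEq V] {E : Type*} [Fintype E] {I : Type*} [Fintype I]
  {K : Type*} [Fintype K] {σ : K → Type*} [∀ k, Fintype (σ k)] [∀ k, DecidableEq (σ k)]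

/-- theorem (the inequality-form bound with trace bounds ONLY on the blocks that need them).
`lmiForm_bound` asks for a trace bound `tr M_k(y) ≤ τ_k` on every block `k`; the bound only USES it
where the eigen-shift is negative. This corollary takes a set `B` of blocks with problem-side trace
bounds `τ_k (k ∈ B)` and requires `d_k ≥ 0` off `B` (there `τ_k := tr M_k(y)` is supplied internally,
`le_rfl`, and its charge `|min(0,d_k)| τ_k` vanishes): every feasible `y` satisfies
`β − Σ_{v≠u} |r_v| ρ_v − Σ_{k ∈ B} |min(0, d_k)| τ_k ≤ c·y + c₀` — the exact analogue of the set `B` of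
a-priori-bounded blocks in Theorem 3.2 (`d_j ≥ 0` for `j ∉ B`, their (3.6)).
SOURCE: [cite: JanssonChaykinKeil2008, Thm 3.2 (3.5)–(3.6) and Lemma 3.1 (inequality-form
corollary)] — a COROLLARY of `lmiForm_bound`; DEVIATIONS from print: inequality (LMI) form, as
`lmiForm_bound`. CERTIFICATE KIND: conic/1 with `trace_bound` present on some blocks only (certsdp
problem/1: `trace_bound: null` elsewhere; rigor.certify then forces `d_k ≥ 0` by the diagonal shift
`diag_shift_scaled`); FIELDS: `B ↦ blocks with a trace bound`, `hd ↦ the reader's check d_k ≥ 0 off B`,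
the rest as in `lmiForm_bound`.
NOT COVERED: as `lmiForm_bound` (exact residuals; unbounded variables; the float producer). -/
theorem lmiForm_bound_traceBoundOn (c : V → ℝ) (c0 : ℝ) (u : V)
    (rowE : E → V → ℝ) (rhs : E → ℝ) (rowI : I → V → ℝ) (upper : I → ℝ)
    (Cb : ∀ k, Matrix (σ k) (σ k) ℝ) (F : ∀ k, V → Matrix (σ k) (σ k) ℝ) (ρ : V → ℝ)
    -- a feasible point
    {y : V → ℝ} (hyu : y u = 1) (hρ : ∀ v, v ≠ u → |y v| ≤ ρ v)
    (heq : ∀ e, ∑ v, rowE e v * y v = rhs e) (hineq : ∀ i, ∑ v, rowI i v * y v ≤ upper i)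
    (hpsd : ∀ k, (Cb k + ∑ v, y v • F k v).PosSemidef)
    -- trace bounds on the blocks of `B` only
    (B : Finset K) (τ : K → ℝ) (hτ : ∀ k ∈ B, trace (Cb k + ∑ v, y v • F k v) ≤ τ k)
    -- the certificate, with nonnegative eigen-shift off `B`
    (lam : E → ℝ) (κ : I → ℝ) (hκ : ∀ i, 0 ≤ κ i) (Z : ∀ k, Matrix (σ k) (σ k) ℝ) (dZ : K → ℝ)
    (hZ : ∀ k, (Z k - dZ k • (1 : Matrix (σ k) (σ k) ℝ)).PosSemidef) (hd : ∀ k ∉ B, 0 ≤ dZ k)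
    (r : V → ℝ)
    (hr : ∀ v, r v = c v - ∑ e, lam e * rowE e v + ∑ i, κ i * rowI i v - ∑ k, trace (Z k * F k v))
    (β : ℝ)
    (hβ : β = c0 + r u + ∑ e, lam e * rhs e - ∑ i, κ i * upper i - ∑ k, trace (Z k * Cb k)) :
    β - ∑ v ∈ Finset.univ.erase u, |r v| * ρ v - ∑ k ∈ B, |min 0 (dZ k)| * τ k ≤
      ∑ v, c v * y v + c0 := by
  classical
  have h := lmiForm_bound c c0 u rowE rhs rowI upper Cb F ρ
    (fun k => if k ∈ B then τ k else trace (Cb k + ∑ v, y v • F k v)) hyu hρ heq hineq hpsd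
    (fun k => by
      show trace (Cb k + ∑ v, y v • F k v) ≤ (if k ∈ B then τ k else trace (Cb k + ∑ v, y v • F k v))
      split_ifs with hk
      · exact hτ k hk
      · exact le_rfl)
    lam κ hκ Z dZ hZ r hr β hβ
  have hsum : ∑ k, |min 0 (dZ k)| * (if k ∈ B then τ k else trace (Cb k + ∑ v, y v • F k v)) =
      ∑ k ∈ B, |min 0 (dZ k)| * τ k := by
    rw [← Finset.sum_subset (Finset.subset_univ B) (fun k _ hk => by
      rw [min_eq_left (hd k hk), abs_zero, zero_mul])]
    exact Finset.sum_congr rfl fun k hk => by rw [if_pos hk]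
  rw [hsum] at h
  exact h

end TraceBoundOn

end JanssonChaykinKeil

end Literature.Computation.Certificates
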